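import Literature.NumberTheory.Automorphic.AdelicRowVectorTwist
import Mathlib.RepresentationTheory.Basic
import Mathlib.LinearAlgebra.Eigenspace.Basic
import Mathlib.NumberTheory.LSeries.RiemannZeta
import Mathlib.Analysis.Analytic.Order
import Mathlib.Analysis.Calculus.ContDiff.Basic
import Mathlib.Analysis.SpecialFunctions.Pow.Real
import HarnessLib

/-!
# Meyer's global difference representation of the idele class group

Topic `NumberTheory/Automorphic`; namespace `Literature.NumberTheory.Automorphic` (grouping
sub-namespace `Meyer` for the objects of the paper). For a number field `K` with adele ring
`𝔸_K` (Mathlib `AdeleRing (𝓞 K) K`), idele group `𝕀_K` (`GaloisRepresentations.ideleGroup K`) and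
idele class group `C_K = 𝕀_K ⧸ Kˣ` (`IdeleClassGroup K`, with its norm `|·| : C_K →* ℝ≥0`), this file
sets up the objects of R. Meyer, *On a representation of the idele class group related to primes and
zeros of L-functions*, Duke Math. J. 127 (2005) [Meyer2005], §1 (pp. 3–5 of arXiv:math/0311468)
and §§4.1, 5.2–5.5, 5.7:

1. `Meyer.schwartzBruhatAdele K = 𝒮(𝔸_K)` — the Bruhat–Schwartz space of the adele ring (the
   restricted tensor product `𝒮(K_∞) ⊗ ⊗'_v 𝒮(K_v)`, i.e. finite sums of `Φ_∞ ⊗ Φ_f` with `Φ_∞`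
   Schwartz on `K_∞ ≅ ℝ^{r₁} × ℂ^{r₂}` and `Φ_f` locally constant of compact support on `𝔸_K^∞`;
   realised as the one-variable case of the tree's `piSchwartzBruhat K (Fin 1)`), with the dilation
   action `Meyer.adeleDilation`, `(λ_g f)(x) = f(g⁻¹ x)` of `𝕀_K` [Meyer2005, §1 p. 4] and its
   stability `Meyer.adeleDilation_mem_schwartzBruhatAdele`.
2. `Meyer.ideleClassSchwartz K = 𝒮(C_K)` — the Bruhat–Schwartz space of the idele class group
   (Bruhat's direct-union definition [Meyer2005, §4.1] unwound for `C_K`, see the docstring), the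
   regular representation `Meyer.classTranslate` (`λ_g f (x) = f (g⁻¹ x)`), the weighted spaces
   `Meyer.ideleClassSchwartzWeighted K I = 𝒮(C_K)_I = {f | f·|x|^α ∈ 𝒮(C_K) ∀ α ∈ I}`
   [Meyer2005, Def. 4.1], `H₋ = 𝒮(C_K)_ℝ` and `𝒮(C_K)_{><} = 𝒮(C_K)_{(1,∞)} ⊕ 𝒮(C_K)_{(-∞,0)}`
   [Meyer2005, (1.2)–(1.3) and §5.3].
3. The summation map `Σ f (x) = ∑_{a ∈ Kˣ} f(a x)` (`Meyer.meyerSum`), `J f (x) = |x|⁻¹ f(x⁻¹)`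
   (`Meyer.invJ`), the adelic Fourier transform `𝔉 f (ξ) = ∫ f(x) ψ(x ξ) dx` for Tate's character
   `ψ = adeleAddChar K` and a Haar measure `μ` (a parameter; Meyer's is the SELF-DUAL one,
   `μ(𝔸_K ⧸ K) = 1`, i.e. `μ (adeleFundamentalDomain K) = 1`), and the maps
   `i₊ f = (Σ f, J Σ 𝔉 f)`, `i₋ f = (f, f)` of [Meyer2005, (1.4)].
4. `Meyer.Hplus K μ` — the coinvariant space `H₊ = 𝒮(𝔸_K)/Kˣ` in Meyer's realisation
   `H₊ ≅ i₊(H₊) ⊆ 𝒮(C_K)_{><}` [Meyer2005, p. 5 L1–5 and §5.3: "we may identify `H₊` with its image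
   `i₊(H₊)`"]; `Meyer.HminusIm = i₋(H₋)`; `Meyer.Hsum = H₊ + H₋`;
   `H⁰₊ = (H₊ + H₋)/H₋`, `H⁰₋ = (H₊ + H₋)/H₊` with the induced representations `π_±` of `C_K`
   (`Meyer.piPlus`, `Meyer.piMinus`) and the GLOBAL DIFFERENCE REPRESENTATION
   `MeyerDifferenceRepresentation K μ = (π₊, π₋)`, a virtual representation `π₊ ⊖ π₋`
   [Meyer2005, §1 p. 5 and §5.5]; the unramified parts `Meyer.unramifiedPart ρ = ρ^{𝒪̂ˣ}`
   (Meyer's `V^S` for `S` the infinite places, §5.1).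
5. Meyer's spectral notions for representations of abelian groups [Meyer2005, §2.3]:
   `jointSpectrum ρ` (quasi-characters `ω` CONTAINED in `ρ`, i.e. admitting a joint eigenvector) and
   the algebraic multiplicity `algMultiplicity ρ ω` (the maximal number of times `ℂ(ω)` occurs in a
   Jordan–Hölder series of a finite-dimensional subrepresentation).
6. NAMED FACTS (not proved here): `Meyer.piPlus_two_dimensional` (`π₊` is 2-dimensional with
   spectrum `{1, |x|}` [Meyer2005, §1 p. 5, Lemma 5.5]) and `Meyer.spectralRealisation_rat` (for
   `K = ℚ` and the unramified quasi-characters `ω = |x|^s`: the algebraic multiplicity of `|x|^s` in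
   `π₋` is the order of vanishing of the completed zeta function `Λ(s) = π^{-s/2} Γ(s/2) ζ(s)`
   (Mathlib `completedRiemannZeta`) at `s`, for `s ≠ 0, 1`, and the two poles `s = 0, 1` do not
   occur in `π₋` [Meyer2005, §1 p. 3 and Thm. 5.11]).
7. For the Hilbert variants mentioned in [Meyer2005, §1 p. 4] ("we can modify `π` so that it lives on
   a Banach space, even a Hilbert space"): the weighted `L²`-seminorms `Meyer.weightedL2Seminorm`.

## Design notes (what is and is not formalised)

* No topology/bornology is put on `𝒮(𝔸_K)`, `𝒮(C_K)`: the spaces are `ℂ`-submodules of function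
  spaces and the representations are Mathlib `Representation`s (abstract group actions). Meyer's
  `H₊` is the quotient of `𝒮(𝔸_K)` by the CLOSED span of `{λ_a f - f}`; by [Meyer2005, Thm. 5.1 and
  Lemma 5.4] the map `i₊` is injective on that quotient, so `H₊` is, as a representation, exactly the
  subspace `i₊(𝒮(𝔸_K))` of pairs of functions on `C_K` — which is how it is defined here (as the
  `λ`-invariant span of `i₊(𝒮(𝔸_K))`; the translates and the span are redundant by the equivariance
  and linearity of `i₊` on `𝒮(𝔸_K)` [Meyer2005, Lemmas 5.3–5.4], which we do not prove). The sums,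
  intersections and quotients defining `H⁰_±` are algebraic in [Meyer2005, §5.5] as well, and the
  spectrum / algebraic multiplicity of [Meyer2005, §2.3] are purely algebraic notions, so the named
  facts below are statements about exactly Meyer's objects.
* `𝒮(C_K)`: Bruhat's `𝒮(G) = lim_{k ⊆ U} 𝒮(U/k)` over compact `k` with `U/k` elementary abelian
  [Meyer2005, §4.1]. For `G = C_K` (compactly generated, `C_K¹` compact) such `k` contain an open
  subgroup of the finite idele units, `C_K/k` is a Lie group `ℝ × T^c × F` whose one non-compact
  direction is `log |x|`, and rapid decay is measured by `(1 + |log |x||)^β` [Meyer2005, proof of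
  Lemma 5.2]; so `f ∈ 𝒮(C_K)` iff `f` is invariant under an open subgroup of `(𝔸_K^∞)ˣ`, smooth along
  the archimedean one-parameter subgroups `X ↦ x·exp(X)`, `X ∈ K_∞ ≅ ℝ^{r₁} × ℂ^{r₂}`, with all such
  derivatives `O((1 + |log |x||)^{-β})` for every `β` — the three fields of `Meyer.IsIdeleClassSchwartz`.
* The Haar measure `μ` on `𝔸_K` is a parameter of `𝔉`, hence of `H₊, H⁰_±, π_±`; the named facts
  assume Meyer's self-dual normalisation `μ (adeleFundamentalDomain K) = 1` [Meyer2005, §5.1].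
* Only `K = ℚ` and unramified `ω` in `spectralRealisation_rat`: Meyer's `L_K(χ |x|^s) = L(χ, s)`
  for all Hecke characters needs completed Hecke `L`-functions as meromorphic functions, which neither
  Mathlib nor the tree has; the stated case is the one Mathlib can express (`completedRiemannZeta`).
* Not here: summability/boundedness of `π`, the local and global trace formulas, the Weil
  distribution, the `S`-local spaces `T(C_S)`, Theorem 5.1 (derived coinvariants), the PNT of §6.

## References

* R. Meyer, *On a representation of the idele class group related to primes and zeros of
  L-functions*, Duke Math. J. 127 (2005), 519–595 = arXiv:math/0311468: §1 pp. 3–5, §2.3, §4.1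
  (Def. 4.1), §5.1–5.5 (Lemmas 5.3–5.5, Thm. 5.8), §5.7 (Thm. 5.11) [Meyer2005].
* F. Bruhat, *Distributions sur un groupe localement compact …* (1961) [Bruhat1961].
* A. Connes, *Trace formula in noncommutative geometry and the zeros of the Riemann zeta function*,
  Selecta Math. 5 (1999) [Connes1999].
* J. Tate, in Cassels–Fröhlich, *Algebraic Number Theory* (1967), Ch. XV [CasselsFrohlichANT1967].
-/

noncomputable section

open MeasureTheory NumberField NumberField.InfinitePlace NumberField.mixedEmbedding IsDedekindDomain
open scoped SchwartzMap NNReal ENNReal ContDiff Classical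

namespace Literature.NumberTheory.Automorphic

/-! ### Spectrum and algebraic multiplicity of a representation of an abelian group (Meyer §2.3) -/

section Spectrum

variable {k G V : Type*} [Field k] [Monoid G] [AddCommGroup V] [Module k V]

/-- The **spectrum** of a representation `ρ` of `G` on `V` in the sense of [Meyer2005, §2.3]: the set
of (quasi-)characters `χ : G → k` CONTAINED in `ρ`, i.e. such that there is a non-zero equivariant
map `k(χ) → V` — equivalently a joint eigenvector `v ≠ 0`, `ρ(g) v = χ(g) v` for all `g`. (Meyer:
"this definition is only reasonable for summable representations"; for those every `χ` in the
spectrum is a continuous quasi-character.) [cite: Meyer2005, §2.3] -/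
def jointSpectrum (ρ : Representation k G V) : Set (G → k) :=
  {χ | ∃ v : V, v ≠ 0 ∧ ∀ g : G, ρ g v = χ g • v}

/-- Membership in the spectrum: existence of a joint eigenvector. [cite: Meyer2005, §2.3] -/
theorem mem_jointSpectrum_iff (ρ : Representation k G V) (χ : G → k) :
    χ ∈ jointSpectrum ρ ↔ ∃ v : V, v ≠ 0 ∧ ∀ g : G, ρ g v = χ g • v :=
  Iff.rfl

/-- The joint generalised eigenspace `⋂_g ⋃_n ker (ρ(g) - χ(g))ⁿ` of the character `χ`. For a
finite-dimensional `G`-invariant subspace `W` (abelian `G`, `k` algebraically closed),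
`W ⊓ jointGenEigenspace ρ χ` is the `χ`-primary component of `W`, whose dimension is the number of
times `k(χ)` occurs in a Jordan–Hölder series of `W`. [folklore] -/
def jointGenEigenspace (ρ : Representation k G V) (χ : G → k) : Submodule k V :=
  ⨅ g : G, Module.End.maxGenEigenspace (ρ g) (χ g)

/-- Membership in the joint generalised eigenspace. [folklore] -/
theorem mem_jointGenEigenspace_iff (ρ : Representation k G V) (χ : G → k) (v : V) :
    v ∈ jointGenEigenspace ρ χ ↔ ∀ g : G, ∃ n : ℕ, ((ρ g - χ g • (1 : Module.End k V)) ^ n) v = 0 := by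
  simp only [jointGenEigenspace, Submodule.mem_iInf, Module.End.mem_maxGenEigenspace]

/-- The **algebraic multiplicity** `mult(χ, ρ) ∈ ℕ ∪ {∞}` of the character `χ` in `ρ`
[Meyer2005, §2.3]: the maximal number of times `k(χ)` occurs as a subquotient in a Jordan–Hölder
series of a finite-dimensional `G`-invariant subspace `W ≤ V`, i.e. the supremum over such `W` of
`dim (W ⊓ jointGenEigenspace ρ χ)` (for abelian `G` acting on a finite-dimensional `W` over an
algebraically closed field the `χ`-primary component has a composition series with all factors
`k(χ)` and the other primary components have none). [cite: Meyer2005, §2.3] -/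
def algMultiplicity (ρ : Representation k G V) (χ : G → k) : ℕ∞ :=
  ⨆ (W : Submodule k V) (_ : FiniteDimensional k W) (_ : ∀ g : G, W ≤ W.comap (ρ g)),
    (Module.finrank k ↥(W ⊓ jointGenEigenspace ρ χ) : ℕ∞)

/-- A character in the spectrum has algebraic multiplicity `≥ 1` (the line spanned by a joint
eigenvector is a one-dimensional invariant subspace inside the joint generalised eigenspace).
[cite: Meyer2005, §2.3] -/
theorem one_le_algMultiplicity_of_mem_jointSpectrum {ρ : Representation k G V} {χ : G → k}
    (h : χ ∈ jointSpectrum ρ) : 1 ≤ algMultiplicity ρ χ := by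
  obtain ⟨v, hv0, hv⟩ := h
  set W : Submodule k V := k ∙ v
  have hfin : FiniteDimensional k W := FiniteDimensional.span_of_finite k (Set.finite_singleton v)
  have hinv : ∀ g : G, W ≤ W.comap (ρ g) := by
    intro g w hw
    obtain ⟨c, rfl⟩ := Submodule.mem_span_singleton.mp hw
    rw [Submodule.mem_comap, map_smul, hv g, smul_smul]
    exact Submodule.smul_mem _ _ (Submodule.mem_span_singleton_self v)
  have hvJ : v ∈ jointGenEigenspace ρ χ := by
    rw [mem_jointGenEigenspace_iff]
    intro g
    refine ⟨1, ?_⟩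
    simp [hv g]
  have hle : (1 : ℕ∞) ≤ (Module.finrank k ↥(W ⊓ jointGenEigenspace ρ χ) : ℕ∞) := by
    have hmem : v ∈ W ⊓ jointGenEigenspace ρ χ := ⟨Submodule.mem_span_singleton_self v, hvJ⟩
    haveI : FiniteDimensional k ↥(W ⊓ jointGenEigenspace ρ χ) :=
      Submodule.finiteDimensional_inf_left _ _
    have hpos : 0 < Module.finrank k ↥(W ⊓ jointGenEigenspace ρ χ) :=
      Module.finrank_pos_iff_exists_ne_zero.mpr ⟨⟨v, hmem⟩, fun h0 => hv0 (congrArg Subtype.val h0)⟩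
    exact_mod_cast hpos
  refine le_trans hle ?_
  refine le_trans ?_ (le_iSup _ W)
  refine le_trans ?_ (le_iSup _ hfin)
  exact le_iSup (fun _ : ∀ g : G, W ≤ W.comap (ρ g) =>
    (Module.finrank k ↥(W ⊓ jointGenEigenspace ρ χ) : ℕ∞)) hinv

end Spectrum

namespace Meyer

/-! ### The Bruhat–Schwartz space `𝒮(𝔸_K)` and the dilation action of the ideles -/

section Adele

variable (K : Type) [Field K] [NumberField K]

/-- **The Bruhat–Schwartz space `𝒮(𝔸_K)`** of the adele ring [Meyer2005, §1 p. 4 and §5.1: the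
restricted (completed) tensor product of the `𝒮(K_v)` with distinguished vectors `1_{𝒪_v}`], i.e.
the finite sums of `Φ_∞ ⊗ Φ_f` with `Φ_∞` a Schwartz function on `K_∞ ≅ ℝ^{r₁} × ℂ^{r₂}` and `Φ_f`
locally constant of compact support on the finite adeles (Weil's standard functions; finite sums
suffice: `𝒮(𝔸_K^∞) = C_c^∞(𝔸_K^∞)` is the union of the finite-dimensional spaces of functions on
`U/k`, `k ⊆ U` compact open subgroups, so its completed tensor product with the Fréchet space
`𝒮(K_∞)` is the algebraic one). Realised as the
one-variable case of the tree's `piSchwartzBruhat K (Fin 1)` (pull-back along `f ↦ (v ↦ f (v 0))`),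
so that its Fourier stability and Poisson summation (`AdelicPiSchwartzBruhatFourier`) apply.
[cite: Meyer2005, §1 p. 4] -/
def schwartzBruhatAdele : Submodule ℂ (AdeleRing (𝓞 K) K → ℂ) :=
  (piSchwartzBruhat K (Fin 1)).comap
    (LinearMap.funLeft ℂ ℂ fun v : Fin 1 → AdeleRing (𝓞 K) K => v 0)

variable {K} in
/-- Membership in `𝒮(𝔸_K)` is membership of `v ↦ f (v 0)` in `𝒮(𝔸_K^{Fin 1})`. [folklore] -/
theorem mem_schwartzBruhatAdele_iff {f : AdeleRing (𝓞 K) K → ℂ} :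
    f ∈ schwartzBruhatAdele K ↔
      (fun v : Fin 1 → AdeleRing (𝓞 K) K => f (v 0)) ∈ piSchwartzBruhat K (Fin 1) :=
  Iff.rfl

variable {K} in
/-- **Pure tensors `Φ_∞ ⊗ Φ_f` lie in `𝒮(𝔸_K)`**: for `Φ_∞` Schwartz on `K_∞ ≅ ℝ^{r₁} × ℂ^{r₂}`
(Mathlib's `mixedSpace K`, through `InfiniteAdeleRing.ringEquiv_mixedSpace`) and `Φ_f` locally
constant of compact support on `𝔸_K^∞`, `x ↦ Φ_∞(x_∞) Φ_f(x_f)` is Bruhat–Schwartz.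
[cite: Meyer2005, §5.1] -/
theorem tensor_mem_schwartzBruhatAdele (Φinf : 𝓢(mixedSpace K, ℂ))
    {Φfin : FiniteAdeleRing (𝓞 K) K → ℂ} (hfin : Φfin ∈ SchwartzBruhat (FiniteAdeleRing (𝓞 K) K)) :
    (fun x : AdeleRing (𝓞 K) K =>
      Φinf (InfiniteAdeleRing.ringEquiv_mixedSpace K x.1) * Φfin x.2) ∈ schwartzBruhatAdele K := by
  rw [mem_schwartzBruhatAdele_iff]
  obtain ⟨hlc, hcs⟩ := (mem_schwartzBruhat_iff).1 hfin
  have hfin' : (fun y : Fin 1 → FiniteAdeleRing (𝓞 K) K => Φfin (y 0)) ∈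
      SchwartzBruhat (Fin 1 → FiniteAdeleRing (𝓞 K) K) :=
    (mem_schwartzBruhat_iff).2 ⟨hlc.comp_continuous (continuous_apply 0),
      hcs.comp_homeomorph (Homeomorph.funUnique (Fin 1) (FiniteAdeleRing (𝓞 K) K))⟩
  have h := tensor_mem_piSchwartzBruhat (K := K) (ι := Fin 1)
    (SchwartzMap.compCLMOfContinuousLinearEquiv ℂ
      (ContinuousLinearEquiv.funUnique (Fin 1) ℝ (mixedSpace K)) Φinf) hfin'
  convert h using 2 with v
  simp only [SchwartzMap.compCLMOfContinuousLinearEquiv_apply, Function.comp_apply,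
    ContinuousLinearEquiv.coe_funUnique, Function.eval, piArch_apply, piFinite_apply,
    Fin.default_eq_zero]

/-- **The dilation action `λ` of the idele group on functions on `𝔸_K`**, `(λ_g f)(x) = f(g⁻¹ x)`
[Meyer2005, §1 p. 4 and (3.1)], as a `ℂ`-linear representation of `𝕀_K = 𝔸_Kˣ` on `𝔸_K → ℂ`.
[cite: Meyer2005, §1 p. 4] -/
def adeleDilation :
    Representation ℂ (GaloisRepresentations.ideleGroup K) (AdeleRing (𝓞 K) K → ℂ) where
  toFun g :=
    { toFun := fun f x => f (((g⁻¹ : GaloisRepresentations.ideleGroup K) : AdeleRing (𝓞 K) K) * x)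
      map_add' := fun _ _ => rfl
      map_smul' := fun _ _ => rfl }
  map_one' := LinearMap.ext fun f => funext fun x => by simp
  map_mul' g h := LinearMap.ext fun f => funext fun x => by
    simp [mul_assoc]

variable {K} in
/-- Unfolding of the dilation action. [cite: Meyer2005, §1 p. 4] -/
@[simp]
theorem adeleDilation_apply (g : GaloisRepresentations.ideleGroup K) (f : AdeleRing (𝓞 K) K → ℂ)
    (x : AdeleRing (𝓞 K) K) :
    adeleDilation K g f x = f (((g⁻¹ : GaloisRepresentations.ideleGroup K) : AdeleRing (𝓞 K) K) * x) :=
  rfl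

variable {K} in
/-- **`𝒮(𝔸_K)` is stable under the dilations `λ_g`, `g ∈ 𝕀_K`** ("`𝔸_Kˣ` acts smoothly on
`𝒮(𝔸_K)` by `λ`", [Meyer2005, §1 p. 4]); from the tree's `comp_smul_mem_piSchwartzBruhat`.
[cite: Meyer2005, §1 p. 4] -/
theorem adeleDilation_mem_schwartzBruhatAdele {f : AdeleRing (𝓞 K) K → ℂ}
    (hf : f ∈ schwartzBruhatAdele K) (g : GaloisRepresentations.ideleGroup K) :
    adeleDilation K g f ∈ schwartzBruhatAdele K := by
  rw [mem_schwartzBruhatAdele_iff] at hf ⊢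
  have h := comp_smul_mem_piSchwartzBruhat hf g⁻¹
  simpa only [adeleDilation_apply, Pi.smul_apply, smul_eq_mul] using h

/-- `𝒮(𝔸_K)` as a representation of the idele group (restriction of `λ`). [cite: Meyer2005, §1 p. 4] -/
def schwartzBruhatAdeleRep :
    Representation ℂ (GaloisRepresentations.ideleGroup K) ↥(schwartzBruhatAdele K) :=
  (adeleDilation K).subrepresentation (schwartzBruhatAdele K)
    fun g _ hf => adeleDilation_mem_schwartzBruhatAdele hf g

/-- The ALGEBRAIC coinvariants `𝒮(𝔸_K) / span{λ_a f - f : a ∈ Kˣ}` of the principal ideles acting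
on `𝒮(𝔸_K)` (Mathlib `Representation.Coinvariants`). Meyer's `H₊ := 𝒮(𝔸_K)/Kˣ` is the quotient by
the CLOSED span [Meyer2005, (1.1)], a quotient of this space; it is realised concretely as
`Meyer.Hplus` below. [cite: Meyer2005, §1 (1.1)] -/
abbrev algCoinvariants : Type :=
  Representation.Coinvariants (k := ℂ) (G := Kˣ) (V := ↥(schwartzBruhatAdele K))
    ((schwartzBruhatAdeleRep K).comp
      (Units.map (algebraMap K (AdeleRing (𝓞 K) K) : K →* AdeleRing (𝓞 K) K)))

/-! ### The summation map, `J` and the adelic Fourier transform -/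

/-- The summation map on ideles, `Σ f (x) = ∑_{a ∈ Kˣ} f(a x)` [Meyer2005, §1 p. 4 and §5.3]
(an unconditional sum, `0` if not summable; absolutely convergent for `f ∈ 𝒮(𝔸_K)`).
[cite: Meyer2005, §5.3] -/
def ideleSum (f : AdeleRing (𝓞 K) K → ℂ) (x : GaloisRepresentations.ideleGroup K) : ℂ :=
  ∑' a : Kˣ, f (algebraMap K (AdeleRing (𝓞 K) K) (a : K) * (x : AdeleRing (𝓞 K) K))

variable {K} in
/-- `Σ f` is `Kˣ`-invariant: `Σ f (a x) = Σ f (x)` for a principal idele `a` (reindex the sum).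
[cite: Meyer2005, §5.3] -/
theorem ideleSum_mul_principal (f : AdeleRing (𝓞 K) K → ℂ) (x : GaloisRepresentations.ideleGroup K)
    (c : Kˣ) :
    ideleSum K f (x * Units.map (algebraMap K (AdeleRing (𝓞 K) K) : K →* AdeleRing (𝓞 K) K) c) =
      ideleSum K f x := by
  unfold ideleSum
  calc ∑' a : Kˣ, f (algebraMap K (AdeleRing (𝓞 K) K) (a : K) *
          ((x * Units.map (algebraMap K (AdeleRing (𝓞 K) K) : K →* AdeleRing (𝓞 K) K) c :
            GaloisRepresentations.ideleGroup K) : AdeleRing (𝓞 K) K))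
        = ∑' a : Kˣ, f (algebraMap K (AdeleRing (𝓞 K) K) ((a * c : Kˣ) : K) *
            (x : AdeleRing (𝓞 K) K)) := by
          refine tsum_congr fun a => ?_
          congr 1
          simp only [Units.val_mul, Units.coe_map, MonoidHom.coe_coe, map_mul]
          ring
    _ = ∑' a : Kˣ, f (algebraMap K (AdeleRing (𝓞 K) K) (a : K) * (x : AdeleRing (𝓞 K) K)) :=
          (Equiv.mulRight c).tsum_eq fun a : Kˣ =>
            f (algebraMap K (AdeleRing (𝓞 K) K) (a : K) * (x : AdeleRing (𝓞 K) K))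

/-- **The summation map `Σ : 𝒮(𝔸_K) → functions on C_K`**, `Σ f (x) = ∑_{a ∈ Kˣ} f(a x)` for
`x ∈ C_K` [Meyer2005, §1 p. 4; §5.3, Lemma 5.3: a bounded map `H₊ → 𝒮(C_K)_{(1,∞)}`], descended from
`ideleSum` along `𝕀_K → C_K`. [cite: Meyer2005, §5.3, Lemma 5.3] -/
def meyerSum (f : AdeleRing (𝓞 K) K → ℂ) : IdeleClassGroup K → ℂ :=
  Quotient.lift (ideleSum K f) fun a b hab => by
    obtain ⟨c, hc⟩ := (QuotientGroup.leftRel_apply).mp hab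
    have hb : b = a * Units.map (algebraMap K (AdeleRing (𝓞 K) K) : K →* AdeleRing (𝓞 K) K) c := by
      rw [hc, mul_inv_cancel_left]
    rw [hb, ideleSum_mul_principal]

variable {K} in
/-- `Σ f` on the class of an idele is the idelic sum. [cite: Meyer2005, §5.3] -/
@[simp]
theorem meyerSum_mk (f : AdeleRing (𝓞 K) K → ℂ) (x : GaloisRepresentations.ideleGroup K) :
    meyerSum K f (x : IdeleClassGroup K) = ideleSum K f x :=
  rfl

/-- The norm of an idele class as a real number, `|x| ∈ ℝ_{>0}` (coercion of `IdeleClassGroup.norm`).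
[folklore] -/
abbrev classNorm (x : IdeleClassGroup K) : ℝ := (IdeleClassGroup.norm K x : ℝ)

variable {K} in
/-- The norm of an idele class is non-zero. [folklore] -/
theorem classNorm_ne_zero (x : IdeleClassGroup K) : classNorm K x ≠ 0 := by
  have h : IdeleClassGroup.norm K x * IdeleClassGroup.norm K x⁻¹ = 1 := by
    rw [← map_mul, mul_inv_cancel, map_one]
  have h' : IdeleClassGroup.norm K x ≠ 0 := left_ne_zero_of_mul_eq_one h
  exact NNReal.coe_ne_zero.mpr h'

variable {K} in
/-- The norm of an idele class is positive. [folklore] -/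
theorem classNorm_pos (x : IdeleClassGroup K) : 0 < classNorm K x :=
  lt_of_le_of_ne (NNReal.coe_nonneg _) (classNorm_ne_zero x).symm

/-- **Meyer's involution `J`**, `J f (x) = |x|⁻¹ f(x⁻¹)` on functions on `C_K` [Meyer2005, §1 p. 4
and (3.3)]. [cite: Meyer2005, §1 p. 4] -/
def invJ : (IdeleClassGroup K → ℂ) →ₗ[ℂ] (IdeleClassGroup K → ℂ) where
  toFun f x := ((classNorm K x : ℝ) : ℂ)⁻¹ * f x⁻¹
  map_add' f g := funext fun x => by simp [mul_add]
  map_smul' c f := funext fun x => by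
    simp only [Pi.smul_apply, smul_eq_mul, RingHom.id_apply]
    ring

variable {K} in
/-- Unfolding of `J`. [cite: Meyer2005, §1 p. 4] -/
@[simp]
theorem invJ_apply (f : IdeleClassGroup K → ℂ) (x : IdeleClassGroup K) :
    invJ K f x = ((classNorm K x : ℝ) : ℂ)⁻¹ * f x⁻¹ :=
  rfl

/-- **Meyer's embedding `i₋`** [Meyer2005, (1.4)]: `i₋ f = (f, f)`. [cite: Meyer2005, §1 (1.4)] -/
def iMinus : (IdeleClassGroup K → ℂ) →ₗ[ℂ] (IdeleClassGroup K → ℂ) × (IdeleClassGroup K → ℂ) :=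
  LinearMap.id.prod LinearMap.id

variable {K} in
/-- Unfolding of `i₋`. [cite: Meyer2005, §1 (1.4)] -/
@[simp]
theorem iMinus_apply (f : IdeleClassGroup K → ℂ) : iMinus K f = (f, f) :=
  rfl

variable [MeasurableSpace (AdeleRing (𝓞 K) K)]

/-- **The adelic Fourier transform** `𝔉 f (ξ) = ∫_{𝔸_K} f(x) ψ(x ξ) dμ(x)` [Meyer2005, (3.2) and
§5.1] for Tate's character `ψ = adeleAddChar K` (trivial on `K`, non-trivial: a *normalised*
character in Meyer's sense) and a measure `μ` on `𝔸_K` — Meyer's `μ` is the self-dual Haar measure,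
characterised by `μ(𝔸_K ⧸ K) = 1`, i.e. `μ (adeleFundamentalDomain K) = 1`. At `ξ ∈ K` these are the
Fourier coefficients `adeleFourierCoeff μ f ξ` of `AdelicPoissonSummation` (`ψ(ξ x) = ψ(x ξ)`).
[cite: Meyer2005, §3.1 (3.2) and §5.1] -/
def adeleFourier (μ : Measure (AdeleRing (𝓞 K) K)) (f : AdeleRing (𝓞 K) K → ℂ)
    (ξ : AdeleRing (𝓞 K) K) : ℂ :=
  ∫ x, f x * (adeleAddChar K (x * ξ) : ℂ) ∂μ

/-- **Meyer's embedding `i₊`** [Meyer2005, (1.4)]: `i₊ f = (Σ f, J Σ 𝔉 f)`, a pair of functions on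
`C_K` (for `f ∈ 𝒮(𝔸_K)` it lies in `𝒮(C_K)_{(1,∞)} ⊕ 𝒮(C_K)_{(-∞,0)}`, Lemmas 5.3–5.4).
[cite: Meyer2005, §1 (1.4)] -/
def iPlus (μ : Measure (AdeleRing (𝓞 K) K)) (f : AdeleRing (𝓞 K) K → ℂ) :
    (IdeleClassGroup K → ℂ) × (IdeleClassGroup K → ℂ) :=
  (meyerSum K f, invJ K (meyerSum K (adeleFourier K μ f)))

end Adele

/-! ### The Bruhat–Schwartz space `𝒮(C_K)` of the idele class group and its weighted versions -/

section IdeleClass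

variable (K : Type) [Field K] [NumberField K]

/-- The componentwise exponential of `K_∞ ≅ ℝ^{r₁} × ℂ^{r₂}` (Mathlib's `mixedSpace K`), a unit
`(e^{X_w})_w` with inverse `(e^{-X_w})_w`: the exponential map of the commutative real Lie group
`K_∞ˣ = ∏_{w real} ℝˣ × ∏_{w complex} ℂˣ`, a homomorphism `(K_∞, +) → K_∞ˣ` onto the identity
component. [folklore] -/
def mixedExpUnit (X : mixedSpace K) : (mixedSpace K)ˣ where
  val := (fun w => Real.exp (X.1 w), fun w => Complex.exp (X.2 w))
  inv := (fun w => Real.exp (-X.1 w), fun w => Complex.exp (-X.2 w))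
  val_inv := by
    refine Prod.ext (funext fun w => ?_) (funext fun w => ?_)
    · simp [← Real.exp_add]
    · simp [← Complex.exp_add]
  inv_val := by
    refine Prod.ext (funext fun w => ?_) (funext fun w => ?_)
    · simp [← Real.exp_add]
    · simp [← Complex.exp_add]

/-- The archimedean one-parameter directions in `C_K`: `X ↦` the class of the idele which is
`exp X` at the infinite places (through `InfiniteAdeleRing.ringEquiv_mixedSpace`) and `1` at the
finite places. [folklore] -/
def archExpClass (X : mixedSpace K) : IdeleClassGroup K :=
  IdeleClassGroup.mk K (GaloisRepresentations.infiniteIdeles K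
    (Units.map ((InfiniteAdeleRing.ringEquiv_mixedSpace K).symm :
        mixedSpace K ≃+* InfiniteAdeleRing K).toMonoidHom (mixedExpUnit K X)))

/-- The archimedean orbit map of `f : C_K → ℂ` at `x`: `X ↦ f (x · exp X)` on `K_∞ ≅ ℝ^{r₁} × ℂ^{r₂}`
(smoothness of `f` on the Lie group `C_K/k`, `k` open in the finite idele units, is smoothness of
these maps; invariant differential operators are their derivatives at `X = 0`). [folklore] -/
def archOrbit (f : IdeleClassGroup K → ℂ) (x : IdeleClassGroup K) : mixedSpace K → ℂ :=
  fun X => f (x * archExpClass K X)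

/-- The finite idele units `(𝔸_K^∞)ˣ → C_K` (idele `(1, u)`, then its class). [folklore] -/
def finiteUnitClass : (FiniteAdeleRing (𝓞 K) K)ˣ →* IdeleClassGroup K :=
  (IdeleClassGroup.mk K).toMonoidHom.comp
    (Units.map (MonoidHom.inr (InfiniteAdeleRing K) (FiniteAdeleRing (𝓞 K) K) :
      FiniteAdeleRing (𝓞 K) K →* AdeleRing (𝓞 K) K))

/-- The weights `(1 + |log |x||)^β` measuring rapid decay on `C_K` (the norm `|x| : C_K → ℝ_{>0}` is
proper, [Meyer2005, proof of Lemma 5.2]). [cite: Meyer2005, Lemma 5.2 (proof)] -/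
def logWeight (β : ℕ) (x : IdeleClassGroup K) : ℝ :=
  (1 + |Real.log (classNorm K x)|) ^ β

variable {K} in
/-- The weights are non-negative. [folklore] -/
theorem logWeight_nonneg (β : ℕ) (x : IdeleClassGroup K) : 0 ≤ logWeight K β x :=
  pow_nonneg (by positivity) β

variable {K} in
/-- The norm of a product of idele classes. [folklore] -/
theorem classNorm_mul (x y : IdeleClassGroup K) : classNorm K (x * y) = classNorm K x * classNorm K y := by
  simp [classNorm, map_mul]

variable {K} in
/-- Submultiplicativity of the weights: `(1 + |log |g x||)^β ≤ (1 + |log |g||)^β (1 + |log |x||)^β`.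
[folklore] -/
theorem logWeight_mul_le (β : ℕ) (g x : IdeleClassGroup K) :
    logWeight K β (g * x) ≤ logWeight K β g * logWeight K β x := by
  unfold logWeight
  rw [← mul_pow, classNorm_mul, Real.log_mul (classNorm_ne_zero g) (classNorm_ne_zero x)]
  refine pow_le_pow_left₀ (by positivity) ?_ β
  have h1 := abs_add_le (Real.log (classNorm K g)) (Real.log (classNorm K x))
  nlinarith [abs_nonneg (Real.log (classNorm K g)), abs_nonneg (Real.log (classNorm K x))]

/-- **Bruhat–Schwartz functions on the idele class group** [Meyer2005, §4.1 (Bruhat's `𝒮(G)`), with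
§5.1–5.2 and the proof of Lemma 5.2], unwound for `G = C_K`: `f : C_K → ℂ` is Bruhat–Schwartz iff
(i) `f` is invariant under an open subgroup of the finite idele units `(𝔸_K^∞)ˣ` (smooth vector for
the totally disconnected part: `f` factors through the Lie group `C_K/k`), (ii) `f` is smooth along the
archimedean one-parameter subgroups, `X ↦ f(x·exp X)` is `C^∞` on `K_∞` for every `x`, and (iii) every
such derivative decays faster than any power of `log |x|`, uniformly on `C_K`
(`𝒮(C_K/k) = 𝒮(ℝ × T^c × F)`, the `ℝ`-coordinate being `log |x|`). Bruhat's general definition is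
the bornological direct union of the `𝒮(U/k)` over compact `k ⊆ U` with `U/k` elementary abelian;
no bornology is recorded here. [cite: Meyer2005, §4.1 and Lemma 5.2] -/
structure IsIdeleClassSchwartz (f : IdeleClassGroup K → ℂ) : Prop where
  /-- invariance under an open subgroup of the finite idele units -/
  exists_openSubgroup : ∃ U : OpenSubgroup (FiniteAdeleRing (𝓞 K) K)ˣ,
    ∀ u ∈ U, ∀ x : IdeleClassGroup K, f (x * finiteUnitClass K u) = f x
  /-- smoothness along the archimedean one-parameter subgroups -/
  contDiff : ∀ x : IdeleClassGroup K, ContDiff ℝ ∞ (archOrbit K f x)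
  /-- rapid decay of all archimedean derivatives in `log |x|` -/
  decay : ∀ n β : ℕ, ∃ C : ℝ, ∀ x : IdeleClassGroup K,
    logWeight K β x * ‖iteratedFDeriv ℝ n (archOrbit K f x) 0‖ ≤ C

variable {K} in
/-- Finite-order smoothness of the archimedean orbit maps of a Bruhat–Schwartz function. [folklore] -/
theorem IsIdeleClassSchwartz.contDiffAt {f : IdeleClassGroup K → ℂ} (hf : IsIdeleClassSchwartz K f)
    (x : IdeleClassGroup K) (n : ℕ) (X : mixedSpace K) : ContDiffAt ℝ n (archOrbit K f x) X :=
  ((hf.contDiff x).of_le (by exact_mod_cast le_top)).contDiffAt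

/-- **The Bruhat–Schwartz space `𝒮(C_K)`** of the idele class group as a `ℂ`-subspace of
`C_K → ℂ` [Meyer2005, §4.1, §5.3]. [cite: Meyer2005, §4.1] -/
def ideleClassSchwartz : Submodule ℂ (IdeleClassGroup K → ℂ) where
  carrier := {f | IsIdeleClassSchwartz K f}
  zero_mem' := by
    refine ⟨⟨⊤, fun _ _ _ => rfl⟩, fun x => contDiff_const (c := (0 : ℂ)), fun n β => ⟨0, fun x => ?_⟩⟩
    have h0 : archOrbit K (0 : IdeleClassGroup K → ℂ) x = fun _ => (0 : ℂ) := rfl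
    rw [h0, iteratedFDeriv_fun_zero]
    simp
  add_mem' {f g} hf hg := by
    refine ⟨?_, fun x => (hf.contDiff x).add (hg.contDiff x), fun n β => ?_⟩
    · obtain ⟨U, hU⟩ := hf.exists_openSubgroup
      obtain ⟨U', hU'⟩ := hg.exists_openSubgroup
      refine ⟨U ⊓ U', fun u hu x => ?_⟩
      simp only [Pi.add_apply, hU u hu.1 x, hU' u hu.2 x]
    · obtain ⟨C, hC⟩ := hf.decay n β
      obtain ⟨C', hC'⟩ := hg.decay n β
      refine ⟨C + C', fun x => ?_⟩
      have hadd : archOrbit K (f + g) x = archOrbit K f x + archOrbit K g x := rfl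
      rw [hadd, iteratedFDeriv_add_apply (hf.contDiffAt x n 0) (hg.contDiffAt x n 0)]
      calc logWeight K β x * ‖iteratedFDeriv ℝ n (archOrbit K f x) 0 + iteratedFDeriv ℝ n (archOrbit K g x) 0‖
          ≤ logWeight K β x * (‖iteratedFDeriv ℝ n (archOrbit K f x) 0‖ +
              ‖iteratedFDeriv ℝ n (archOrbit K g x) 0‖) :=
            mul_le_mul_of_nonneg_left (norm_add_le _ _) (logWeight_nonneg β x)
        _ ≤ C + C' := by rw [mul_add]; exact add_le_add (hC x) (hC' x)
  smul_mem' c f hf := by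
    refine ⟨?_, fun x => (hf.contDiff x).const_smul c, fun n β => ?_⟩
    · obtain ⟨U, hU⟩ := hf.exists_openSubgroup
      exact ⟨U, fun u hu x => by simp only [Pi.smul_apply, hU u hu x]⟩
    · obtain ⟨C, hC⟩ := hf.decay n β
      refine ⟨‖c‖ * C, fun x => ?_⟩
      have hsmul : archOrbit K (c • f) x = c • archOrbit K f x := rfl
      rw [hsmul, iteratedFDeriv_const_smul_apply (hf.contDiffAt x n 0), _root_.norm_smul, mul_left_comm]
      exact mul_le_mul_of_nonneg_left (hC x) (norm_nonneg c)

variable {K} in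
/-- Membership in `𝒮(C_K)`. [cite: Meyer2005, §4.1] -/
theorem mem_ideleClassSchwartz_iff {f : IdeleClassGroup K → ℂ} :
    f ∈ ideleClassSchwartz K ↔ IsIdeleClassSchwartz K f :=
  Iff.rfl

/-- **The regular representation `λ` of `C_K`** on functions, `(λ_g f)(x) = f(g⁻¹ x)`
[Meyer2005, (3.1)]. [cite: Meyer2005, §3.1 (3.1)] -/
def classTranslate : Representation ℂ (IdeleClassGroup K) (IdeleClassGroup K → ℂ) where
  toFun g :=
    { toFun := fun f x => f (g⁻¹ * x)
      map_add' := fun _ _ => rfl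
      map_smul' := fun _ _ => rfl }
  map_one' := LinearMap.ext fun f => funext fun x =>
    congrArg f (((congrArg (· * x) inv_one).trans (one_mul x)))
  map_mul' g h := LinearMap.ext fun f => funext fun x =>
    congrArg f ((congrArg (· * x) (mul_inv_rev g h)).trans (mul_assoc _ _ _))

variable {K} in
/-- Unfolding of `λ`. [cite: Meyer2005, §3.1 (3.1)] -/
@[simp]
theorem classTranslate_apply (g : IdeleClassGroup K) (f : IdeleClassGroup K → ℂ) (x : IdeleClassGroup K) :
    classTranslate K g f x = f (g⁻¹ * x) :=
  rfl

variable {K} in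
/-- The archimedean orbit map of a translate is the orbit map at the translated point. [folklore] -/
theorem archOrbit_classTranslate (g : IdeleClassGroup K) (f : IdeleClassGroup K → ℂ) (x : IdeleClassGroup K) :
    archOrbit K (classTranslate K g f) x = archOrbit K f (g⁻¹ * x) :=
  funext fun X => congrArg f (mul_assoc g⁻¹ x (archExpClass K X)).symm

variable {K} in
/-- **`𝒮(C_K)` is translation invariant** (the regular representation of `C_K` on `𝒮(C_K)`,
[Meyer2005, §4.1: "`G` acts on `𝒮(G)` by the regular representation"]). [cite: Meyer2005, §4.1] -/
theorem IsIdeleClassSchwartz.classTranslate {f : IdeleClassGroup K → ℂ} (hf : IsIdeleClassSchwartz K f)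
    (g : IdeleClassGroup K) : IsIdeleClassSchwartz K (classTranslate K g f) where
  exists_openSubgroup := by
    obtain ⟨U, hU⟩ := hf.exists_openSubgroup
    exact ⟨U, fun u hu x =>
      (congrArg f (mul_assoc g⁻¹ x (finiteUnitClass K u)).symm).trans (hU u hu (g⁻¹ * x))⟩
  contDiff x := by
    rw [archOrbit_classTranslate]
    exact hf.contDiff _
  decay n β := by
    obtain ⟨C, hC⟩ := hf.decay n β
    refine ⟨logWeight K β g * C, fun x => ?_⟩
    rw [archOrbit_classTranslate]
    have hw : logWeight K β x ≤ logWeight K β g * logWeight K β (g⁻¹ * x) :=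
      (congrArg (logWeight K β) (mul_inv_cancel_left g x)).symm.trans_le (logWeight_mul_le β g (g⁻¹ * x))
    calc logWeight K β x * ‖iteratedFDeriv ℝ n (archOrbit K f (g⁻¹ * x)) 0‖
        ≤ logWeight K β g * logWeight K β (g⁻¹ * x) * ‖iteratedFDeriv ℝ n (archOrbit K f (g⁻¹ * x)) 0‖ :=
          mul_le_mul_of_nonneg_right hw (norm_nonneg _)
      _ = logWeight K β g * (logWeight K β (g⁻¹ * x) * ‖iteratedFDeriv ℝ n (archOrbit K f (g⁻¹ * x)) 0‖) :=
          mul_assoc _ _ _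
      _ ≤ logWeight K β g * C := mul_le_mul_of_nonneg_left (hC _) (logWeight_nonneg β g)

variable {K} in
/-- `𝒮(C_K)` is stable under `λ_g`. [cite: Meyer2005, §4.1] -/
theorem classTranslate_mem_ideleClassSchwartz {f : IdeleClassGroup K → ℂ} (hf : f ∈ ideleClassSchwartz K)
    (g : IdeleClassGroup K) : classTranslate K g f ∈ ideleClassSchwartz K :=
  IsIdeleClassSchwartz.classTranslate hf g

/-- Multiplication by the quasi-character `|x|^α` (`α ∈ ℝ`), `f ↦ f·|x|^α` [Meyer2005, §4.1].
[cite: Meyer2005, §4.1] -/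
def weightMul (α : ℝ) : (IdeleClassGroup K → ℂ) →ₗ[ℂ] (IdeleClassGroup K → ℂ) where
  toFun f x := f x * ((classNorm K x ^ α : ℝ) : ℂ)
  map_add' f g := funext fun x => by simp [add_mul]
  map_smul' c f := funext fun x => by simp [mul_assoc]

variable {K} in
/-- Unfolding of `weightMul`. [cite: Meyer2005, §4.1] -/
@[simp]
theorem weightMul_apply (α : ℝ) (f : IdeleClassGroup K → ℂ) (x : IdeleClassGroup K) :
    weightMul K α f x = f x * ((classNorm K x ^ α : ℝ) : ℂ) :=
  rfl

variable {K} in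
/-- `(λ_g f)·|x|^α = |g|^α · λ_g (f·|x|^α)`. [folklore] -/
theorem weightMul_classTranslate (α : ℝ) (g : IdeleClassGroup K) (f : IdeleClassGroup K → ℂ) :
    weightMul K α (classTranslate K g f) =
      ((classNorm K g ^ α : ℝ) : ℂ) • classTranslate K g (weightMul K α f) := by
  funext x
  simp only [weightMul_apply, classTranslate_apply, Pi.smul_apply, smul_eq_mul]
  have hx : classNorm K x = classNorm K g * classNorm K (g⁻¹ * x) :=
    (congrArg (classNorm K) (mul_inv_cancel_left g x)).symm.trans (classNorm_mul g (g⁻¹ * x))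
  rw [hx, Real.mul_rpow (classNorm_pos g).le (classNorm_pos _).le]
  push_cast
  ring

/-- **The weighted Bruhat–Schwartz spaces `𝒮(C_K)_I`** for a set of weights `I ⊆ ℝ`
[Meyer2005, Def. 4.1 and §1 p. 4]: `𝒮(C_K)_I = ⋂_{α ∈ I} 𝒮(C_K)_α`,
`𝒮(C_K)_α = {f : C_K → ℂ | f·|x|^α ∈ 𝒮(C_K)}`. Meyer uses intervals: `H₋ = 𝒮(C_K)_ℝ`
(`Meyer.Hminus`), `𝒮(C_K)_{(1,∞)}`, `𝒮(C_K)_{(-∞,0)}` (`Meyer.schwartzPM`).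
[cite: Meyer2005, Def. 4.1] -/
def ideleClassSchwartzWeighted (I : Set ℝ) : Submodule ℂ (IdeleClassGroup K → ℂ) :=
  ⨅ α ∈ I, (ideleClassSchwartz K).comap (weightMul K α)

variable {K} in
/-- Membership in `𝒮(C_K)_I`: `f·|x|^α ∈ 𝒮(C_K)` for all `α ∈ I`. [cite: Meyer2005, Def. 4.1] -/
theorem mem_ideleClassSchwartzWeighted_iff {I : Set ℝ} {f : IdeleClassGroup K → ℂ} :
    f ∈ ideleClassSchwartzWeighted K I ↔ ∀ α ∈ I, weightMul K α f ∈ ideleClassSchwartz K := by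
  simp [ideleClassSchwartzWeighted, Submodule.mem_iInf]

variable {K} in
/-- The weighted spaces are translation invariant (the regular representation of `C_K` on
`𝒮(C_K)_I`, [Meyer2005, §1 p. 4: "the regular representation of `C_K` on `H₋`"]). [cite: Meyer2005, §1 p. 4] -/
theorem classTranslate_mem_ideleClassSchwartzWeighted {I : Set ℝ} {f : IdeleClassGroup K → ℂ}
    (hf : f ∈ ideleClassSchwartzWeighted K I) (g : IdeleClassGroup K) :
    classTranslate K g f ∈ ideleClassSchwartzWeighted K I := by
  rw [mem_ideleClassSchwartzWeighted_iff] at hf ⊢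
  intro α hα
  rw [weightMul_classTranslate]
  exact Submodule.smul_mem _ _ (classTranslate_mem_ideleClassSchwartz (hf α hα) g)

/-- **`H₋ := 𝒮(C_K)_{(-∞,∞)}`** [Meyer2005, (1.2)], with the regular representation of `C_K`.
[cite: Meyer2005, §1 (1.2)] -/
abbrev Hminus : Submodule ℂ (IdeleClassGroup K → ℂ) :=
  ideleClassSchwartzWeighted K Set.univ

/-- **`𝒮(C_K)_{><} := 𝒮(C_K)_{(1,∞)} ⊕ 𝒮(C_K)_{(-∞,0)}`** [Meyer2005, (1.3) and §5.3], "which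
intentionally leaves out the critical strip"; a subspace of pairs of functions on `C_K`.
[cite: Meyer2005, §1 (1.3)] -/
def schwartzPM : Submodule ℂ ((IdeleClassGroup K → ℂ) × (IdeleClassGroup K → ℂ)) :=
  (ideleClassSchwartzWeighted K (Set.Ioi 1)).prod (ideleClassSchwartzWeighted K (Set.Iio 0))

/-- Meyer's weighted `L²`-seminorm `‖f‖_{L²(C)_α} = ‖f·|x|^α‖_{L²(C, ν)}`
(`L²(C_S)_α := {f | f·|x|^α ∈ L²(C_S, d^×x)}`, [Meyer2005, §3.2 and Lemma 5.2]) for a measure `ν`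
on `C_K` (Meyer: the Haar measure `d^×x`); the Hilbert-space variants of `π` alluded to in
[Meyer2005, §1 p. 4] are completions in such norms. [cite: Meyer2005, §3.2] -/
def l2WeightSeminorm [MeasurableSpace (IdeleClassGroup K)] (ν : Measure (IdeleClassGroup K)) (α : ℝ)
    (f : IdeleClassGroup K → ℂ) : ℝ≥0∞ :=
  eLpNorm (weightMul K α f) 2 ν

end IdeleClass

/-! ### `H₊`, `H₋`, `H⁰_±` and the global difference representation `π = π₊ ⊖ π₋` -/

section Difference

variable (K : Type) [Field K] [NumberField K]

/-- The diagonal regular representation `λ ⊕ λ` of `C_K` on pairs of functions (the action on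
`𝒮(C_K)_{><}`). [cite: Meyer2005, §5.3] -/
def classTranslate₂ :
    Representation ℂ (IdeleClassGroup K) ((IdeleClassGroup K → ℂ) × (IdeleClassGroup K → ℂ)) where
  toFun g := (classTranslate K g).prodMap (classTranslate K g)
  map_one' := by simp only [map_one]; exact LinearMap.prodMap_one
  map_mul' g h := by simp only [map_mul]; exact (LinearMap.prodMap_mul _ _ _ _).symm

variable {K} in
/-- Unfolding of `λ ⊕ λ`. [cite: Meyer2005, §5.3] -/
@[simp]
theorem classTranslate₂_apply (g : IdeleClassGroup K) (p : (IdeleClassGroup K → ℂ) × (IdeleClassGroup K → ℂ)) :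
    classTranslate₂ K g p = (classTranslate K g p.1, classTranslate K g p.2) :=
  rfl

variable [MeasurableSpace (AdeleRing (𝓞 K) K)] (μ : Measure (AdeleRing (𝓞 K) K))

/-- **Meyer's `H₊` realised inside `𝒮(C_K)_{><}`**: the `C_K`-invariant subspace of pairs of
functions on `C_K` generated by `i₊(𝒮(𝔸_K)) = {(Σ f, J Σ 𝔉 f) | f ∈ 𝒮(𝔸_K)}`. Meyer defines
`H₊ := 𝒮(𝔸_K)/Kˣ` (quotient by the closed span of `λ_a f - f`, `a ∈ Kˣ`, [Meyer2005, (1.1)]) with the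
representation of `C_K = 𝔸_Kˣ/Kˣ` induced by `λ`, shows that `i₊ : H₊ → 𝒮(C_K)_{><}` is a
`C_K`-equivariant (bornological) embedding [Meyer2005, Lemmas 5.3–5.4, via Thm. 5.1] and thereafter
identifies `H₊` with `i₊(H₊)` [Meyer2005, §5.3: "Hence we may identify `H₊` with its image"]; by that
equivariance and the linearity of `i₊` on `𝒮(𝔸_K)` the translates and the linear span below add
nothing to the image `i₊(𝒮(𝔸_K))`. Depends on the Haar measure `μ` through `𝔉` (Meyer: self-dual).
[cite: Meyer2005, §1 (1.1), (1.4) and §5.3] -/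
def Hplus : Submodule ℂ ((IdeleClassGroup K → ℂ) × (IdeleClassGroup K → ℂ)) :=
  Submodule.span ℂ {p | ∃ (c : IdeleClassGroup K) (f : AdeleRing (𝓞 K) K → ℂ),
    f ∈ schwartzBruhatAdele K ∧ p = classTranslate₂ K c (iPlus K μ f)}

variable {K μ} in
/-- `i₊ f ∈ H₊` for `f ∈ 𝒮(𝔸_K)`. [cite: Meyer2005, §5.3] -/
theorem iPlus_mem_Hplus {f : AdeleRing (𝓞 K) K → ℂ} (hf : f ∈ schwartzBruhatAdele K) :
    iPlus K μ f ∈ Hplus K μ :=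
  Submodule.subset_span ⟨1, f, hf, by rw [map_one]; rfl⟩

variable {K} in
/-- `H₊` is `C_K`-invariant. [cite: Meyer2005, §5.3, Lemma 5.4] -/
theorem Hplus_le_comap (g : IdeleClassGroup K) : Hplus K μ ≤ (Hplus K μ).comap (classTranslate₂ K g) := by
  rw [Hplus, Submodule.span_le]
  rintro p ⟨c, f, hf, rfl⟩
  refine Submodule.subset_span ⟨g * c, f, hf, ?_⟩
  rw [map_mul]
  rfl

/-- `i₋(H₋) = {(f, f) | f ∈ 𝒮(C_K)_ℝ} ⊆ 𝒮(C_K)_{><}` [Meyer2005, (1.4), §5.3]. [cite: Meyer2005, §1 (1.4)] -/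
def HminusIm : Submodule ℂ ((IdeleClassGroup K → ℂ) × (IdeleClassGroup K → ℂ)) :=
  (Hminus K).map (iMinus K)

variable {K} in
omit [MeasurableSpace (AdeleRing (𝓞 K) K)] in
/-- `i₋(H₋)` is `C_K`-invariant (`i₋` is equivariant). [cite: Meyer2005, §5.3] -/
theorem HminusIm_le_comap (g : IdeleClassGroup K) : HminusIm K ≤ (HminusIm K).comap (classTranslate₂ K g) := by
  rintro p ⟨f, hf, rfl⟩
  exact ⟨classTranslate K g f, classTranslate_mem_ideleClassSchwartzWeighted hf g, rfl⟩

/-- **`H₊ + H₋`**, the sum of `i₊(H₊)` and `i₋(H₋)` [Meyer2005, §5.5] (a subspace of `𝒮(C_K)_{><}` by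
Lemmas 5.3–5.4, equal to `{(f₀, f₁) | f₀ - f₁ = c₀ - c₁|x|⁻¹}` by Poisson summation, Lemma 5.5 — neither
proved here; the sum is taken in all pairs of functions on `C_K`). [cite: Meyer2005, §5.5] -/
def Hsum : Submodule ℂ ((IdeleClassGroup K → ℂ) × (IdeleClassGroup K → ℂ)) :=
  Hplus K μ ⊔ HminusIm K

variable {K} in
/-- `H₊ + H₋` is `C_K`-invariant. [cite: Meyer2005, §5.5] -/
theorem Hsum_le_comap (g : IdeleClassGroup K) : Hsum K μ ≤ (Hsum K μ).comap (classTranslate₂ K g) := by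
  intro p hp
  obtain ⟨a, ha, b, hb, rfl⟩ := Submodule.mem_sup.mp hp
  rw [Submodule.mem_comap, map_add]
  exact Submodule.add_mem_sup (Hplus_le_comap μ g ha) (HminusIm_le_comap g hb)

/-- The representation of `C_K` on `H₊ + H₋` (restriction of `λ ⊕ λ`). [cite: Meyer2005, §5.5] -/
def sumRep : Representation ℂ (IdeleClassGroup K) ↥(Hsum K μ) :=
  (classTranslate₂ K).subrepresentation (Hsum K μ) (Hsum_le_comap μ)

/-- `H₊` as a subspace of `H₊ + H₋`. [cite: Meyer2005, §5.5] -/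
def HplusIn : Submodule ℂ ↥(Hsum K μ) :=
  (Hplus K μ).comap (Hsum K μ).subtype

/-- `H₋` as a subspace of `H₊ + H₋`. [cite: Meyer2005, §5.5] -/
def HminusIn : Submodule ℂ ↥(Hsum K μ) :=
  (HminusIm K).comap (Hsum K μ).subtype

/-- **`H⁰₊ := (H₊ + H₋)/H₋ ≅ H₊/(H₊ ∩ H₋)`** [Meyer2005, §1 p. 5 and §5.5]. [cite: Meyer2005, §5.5] -/
abbrev HzeroPlus : Type :=
  ↥(Hsum K μ) ⧸ HminusIn K μ

/-- **`H⁰₋ := (H₊ + H₋)/H₊ ≅ H₋/(H₊ ∩ H₋)`** [Meyer2005, §1 p. 5 and §5.5]. [cite: Meyer2005, §5.5] -/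
abbrev HzeroMinus : Type :=
  ↥(Hsum K μ) ⧸ HplusIn K μ

/-- **`π₊`**: the representation of `C_K` on `H⁰₊` induced by the regular representation
[Meyer2005, §1 p. 5 and §5.5]. [cite: Meyer2005, §5.5] -/
def piPlus : Representation ℂ (IdeleClassGroup K) (HzeroPlus K μ) :=
  (sumRep K μ).quotient (HminusIn K μ) fun g _ hp => HminusIm_le_comap g hp

/-- **`π₋`**: the representation of `C_K` on `H⁰₋` induced by the regular representation — Meyer's
spectral interpretation of the zeros of `L_K` [Meyer2005, §1 p. 5, §5.5, Thm. 5.11].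
[cite: Meyer2005, §5.5] -/
def piMinus : Representation ℂ (IdeleClassGroup K) (HzeroMinus K μ) :=
  (sumRep K μ).quotient (HplusIn K μ) fun g _ hp => Hplus_le_comap μ g hp

/-- **Meyer's global difference representation `π = π₊ ⊖ π₋`** of the idele class group `C_K`
[Meyer2005, §1 p. 5 and §5.5]: the virtual representation — a PAIR of representations read as a
formal difference [Meyer2005, §1 p. 3] — formed by `π₊` on `H⁰₊ = (H₊ + H₋)/H₋` and `π₋` on
`H⁰₋ = (H₊ + H₋)/H₊`, where `H₊ = 𝒮(𝔸_K)/Kˣ ↪ 𝒮(C_K)_{><}` via `i₊ f = (Σ f, J Σ 𝔉 f)` and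
`H₋ = 𝒮(C_K)_ℝ ↪ 𝒮(C_K)_{><}` via `i₋ f = (f, f)`. Its spectrum consists of the poles (in `π₊`) and
zeros (in `π₋`) of the complete `L`-function of `K` (Thm. 5.11; named facts below). `μ` must be the
self-dual Haar measure on `𝔸_K` (`μ (adeleFundamentalDomain K) = 1`). [cite: Meyer2005, §1 p. 5 and §5.5] -/
def _root_.Literature.NumberTheory.Automorphic.MeyerDifferenceRepresentation :
    Representation ℂ (IdeleClassGroup K) (HzeroPlus K μ) ×
      Representation ℂ (IdeleClassGroup K) (HzeroMinus K μ) :=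
  (piPlus K μ, piMinus K μ)

/-- The unramified quasi-characters `ω_s = |x|^s` of `C_K` (`s ∈ ℂ`), as functions `C_K → ℂ`;
`ω_0 = 1`, `ω_1 = |x|`. [cite: Meyer2005, §1 p. 3] -/
def normChar (s : ℂ) : IdeleClassGroup K → ℂ :=
  fun x => ((classNorm K x : ℝ) : ℂ) ^ s

omit [MeasurableSpace (AdeleRing (𝓞 K) K)] in
/-- The maximal compact subgroup `𝒪̂ˣ = ∏_{v ∤ ∞} 𝒪_vˣ` of the finite ideles `(𝔸_K^∞)ˣ`
(Meyer's `𝒪ˣ_{∁S}` for `S` the set of infinite places, [Meyer2005, §5.1]): the finite ideles `u` with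
`u_v, u_v⁻¹ ∈ 𝒪_v` for all `v`. [cite: Meyer2005, §5.1] -/
def integralFiniteUnits : Subgroup (FiniteAdeleRing (𝓞 K) K)ˣ where
  carrier := {u | ∀ v : HeightOneSpectrum (𝓞 K),
    (u : FiniteAdeleRing (𝓞 K) K) v ∈ v.adicCompletionIntegers K ∧
      ((u⁻¹ : (FiniteAdeleRing (𝓞 K) K)ˣ) : FiniteAdeleRing (𝓞 K) K) v ∈ v.adicCompletionIntegers K}
  one_mem' v := by
    refine ⟨(v.adicCompletionIntegers K).one_mem, ?_⟩
    rw [inv_one]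
    exact (v.adicCompletionIntegers K).one_mem
  mul_mem' {u w} hu hw v := by
    have hmul : ∀ a b : (FiniteAdeleRing (𝓞 K) K)ˣ, ((a * b : (FiniteAdeleRing (𝓞 K) K)ˣ) :
        FiniteAdeleRing (𝓞 K) K) v = (a : FiniteAdeleRing (𝓞 K) K) v * (b : FiniteAdeleRing (𝓞 K) K) v :=
      fun _ _ => rfl
    refine ⟨?_, ?_⟩
    · rw [hmul]
      exact (v.adicCompletionIntegers K).mul_mem _ _ (hu v).1 (hw v).1
    · rw [mul_inv_rev, hmul]
      exact (v.adicCompletionIntegers K).mul_mem _ _ (hw v).2 (hu v).2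
  inv_mem' {u} hu v := ⟨(hu v).2, by simpa only [inv_inv] using (hu v).1⟩

omit [MeasurableSpace (AdeleRing (𝓞 K) K)] in
/-- **The unramified part `V^S` of a representation of `C_K`** for `S` the infinite places
[Meyer2005, §5.1: "`V^S ⊆ V` the subspace of elements invariant under `𝒪ˣ_{∁S}`, called unramified
outside `S`"]: the vectors fixed by the image of `𝒪̂ˣ = ∏_{v ∤ ∞} 𝒪_vˣ` in `C_K` (Mathlib
`Representation.invariants`). For `K = ℚ`, `C_ℚ/𝒪̂ˣ ≅ ℝˣ_{>0}` and the unramified parts of `π_±` carry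
the zeros and poles of the Riemann zeta function alone. [cite: Meyer2005, §5.1] -/
def unramifiedPart {V : Type*} [AddCommGroup V] [Module ℂ V]
    (ρ : Representation ℂ (IdeleClassGroup K) V) : Submodule ℂ V :=
  Representation.invariants (k := ℂ) (G := ↥(integralFiniteUnits K)) (V := V)
    (ρ.comp ((finiteUnitClass K).comp (integralFiniteUnits K).subtype))

end Difference

/-! ### Named facts: the spectrum of `π` (Meyer's Theorem 5.11) -/

section Facts

/-- **`π₊` is two-dimensional with spectrum `{1, |x|}`** [Meyer2005, §1 p. 5 L28–29: "the
representation `π₊` is 2-dimensional and `spec π₊ = {1, |x|}`. These are exactly the two poles of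
`L_K`"; Lemma 5.5 (via the Poisson summation formula) and the proof of Thm. 5.11], for every number
field `K` and the self-dual Haar measure `μ` on `𝔸_K` (`μ(𝔸_K ⧸ K) = 1`). Named fact, not proved
here. [cite: Meyer2005, §1 p. 5 and Lemma 5.5] -/
def piPlus_two_dimensional : Prop :=
  ∀ (K : Type) [Field K] [NumberField K] [MeasurableSpace (AdeleRing (𝓞 K) K)]
    [BorelSpace (AdeleRing (𝓞 K) K)] (μ : Measure (AdeleRing (𝓞 K) K)) [μ.IsAddHaarMeasure],
    μ (adeleFundamentalDomain K) = 1 →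
      Module.finrank ℂ (HzeroPlus K μ) = 2 ∧
        jointSpectrum (piPlus K μ) = {normChar K 0, normChar K 1}

/-- **Meyer's spectral realisation of the zeros, for `K = ℚ` and unramified quasi-characters**
[Meyer2005, Thm. 5.11: "The spectrum of `π` consists of the poles and zeros of the `L`-function
`L_K` and `mult(ω, π) = ord(ω, L_K)`", with §1 p. 3: "The two poles occur in `π₊`, the zeros in `π₋`.
The spectral multiplicity `mult(ω, π)` is equal to the pole order"]. For `K = ℚ` the restriction of
Meyer's complete `L`-function to the unramified quasi-characters `ω_s = |x|^s` is the completed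
Riemann zeta function `Λ(s) = π^{-s/2} Γ(s/2) ζ(s)` (Mathlib `completedRiemannZeta`, simple poles at
`s = 0, 1`, zeros = the non-trivial zeros of `ζ`); since `mult(·, π₊)` vanishes off `{1, |x|}`, the
theorem says: for `s ≠ 0, 1` the algebraic multiplicity of `|x|^s` in `π₋` is the order of vanishing
of `Λ` at `s` (Mathlib `analyticOrderAt`; `Λ` is analytic at such `s`, `differentiableAt_completedZeta`,
so no junk value is involved; in particular `|x|^s ∈ spec π₋ ↔ Λ(s) = 0`), and `|x|^0 = 1`,
`|x|^1 = |x|` (the two poles, which live in `π₊`) are not in `spec π₋`. Here `μ` is the self-dual Haar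
measure on `𝔸_ℚ`. Named fact (the `K = ℚ`, unramified case of Thm. 5.11), not proved here.
[cite: Meyer2005, Thm. 5.11] -/
def spectralRealisation_rat : Prop :=
  ∀ [MeasurableSpace (AdeleRing (𝓞 ℚ) ℚ)] [BorelSpace (AdeleRing (𝓞 ℚ) ℚ)]
    (μ : Measure (AdeleRing (𝓞 ℚ) ℚ)) [μ.IsAddHaarMeasure],
    μ (adeleFundamentalDomain ℚ) = 1 →
      (∀ s : ℂ, s ≠ 0 → s ≠ 1 →
          algMultiplicity (piMinus ℚ μ) (normChar ℚ s) = analyticOrderAt completedRiemannZeta s) ∧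
        normChar ℚ 0 ∉ jointSpectrum (piMinus ℚ μ) ∧ normChar ℚ 1 ∉ jointSpectrum (piMinus ℚ μ)

end Facts

end Meyer

end Literature.NumberTheory.Automorphic
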